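import Literature.Geometry.Lorentzian.CarterSliverCapSmallness
import Mathlib.Analysis.SpecialFunctions.Log.Basic
import HarnessLib

/-!
# The logarithmic length condition of the threshold sliver
(namespace `Literature.Geometry.Lorentzian.Kerr`.)

Bookkeeping for `CarterSliverRegimeKernel.sliverRegime_kernel_le`, continued from
`CarterSliverSmallness`: the condition `100ε_c(log(r₃ − r₊) − log X_low)/κ ≤ 1` controlling the tortoise
length of the low-coefficient stretch `[b₁, s₃]` after the cap. With `u := |S|/(r₊ − r₋) ≤ ξ₁`
(`S = (r₊² + a²)σ`) the ratio `(r₃ − r₊)/X_low` is `≤ 3.88·10¹⁰/(θ₁²u)` while `ε_c/κ ≤ 12u·(r₊² + a²)κ/…`,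
precisely `100ε_c/κ ≤ 1200u`; since `log Q ≤ 2√Q`, the product is `≤ 4.8·10⁸√u/θ₁ ≤ 1` for
`ξ₁ ≤ 10⁻¹⁸θ₁⁴`:

* `sliver_log_small` — the condition, given `A_cap X* ≤ 1` (from `sliver_cap_small`).

Near-extremal Kerr programme, crux `KappaExplicitWaveDecay`. Folklore arithmetic.

## References
* M. Dafermos, I. Rodnianski, Y. Shlapentokh-Rothman, arXiv:1402.7034 = Ann. of Math. 183 (2016),
  §8 (key `DafermosRodnianskiShlapentokhrothman2014`).
-/

noncomputable section

open Set

namespace Literature.Geometry.Lorentzian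

namespace Kerr

section SliverLog

variable {M a ω Λ θ₁ ξ₁ ε₀ : ℝ} {m : ℤ}

set_option maxHeartbeats 400000 in
-- one long chain of elementary inequalities
/-- **The logarithmic length condition of the sliver.** Under the hypotheses of `sliver_cap_small`
(`ξ₁ ≤ 10⁻¹⁸θ₁⁴`, `σ ≠ 0`) and given `A_cap X* ≤ 1`:
`100ε_c(log(r₃ − r₊) − log X_low)/κ ≤ 1`. [folklore] -/
theorem sliver_log_small (hMa : IsSubextremal M a) (ha : M / 2 ≤ |a|) (hadm : IsAdmissibleTriple a ω m Λ)
    (hm : 0 < m) (hε₀ : ε₀ ≤ 1 / (16 * M)) (hcone : |ω - m * horizonAngularVelocity M a| ≤ ε₀ * |(m : ℝ)|)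
    (hθ₁ : 0 < θ₁) (hθ₁1 : θ₁ ≤ 1)
    (hBF : (1 + θ₁) * (2 * rPlus M a * ω) ^ 2 ≤ Λ - 2 * a * m * ω)
    (hξ₁le : ξ₁ ≤ 1e-18 * θ₁ ^ 4)
    (hσ0 : ω - m * horizonAngularVelocity M a ≠ 0)
    (hσ : |ω - m * horizonAngularVelocity M a| ≤ 2 * ξ₁ * surfaceGravity M a)
    {Xs Xl Acap εc CA cQ r₃ : ℝ}
    (hXs : Xs = 24 * ((rPlus M a ^ 2 + a ^ 2) * (ω - m * horizonAngularVelocity M a)) ^ 2 /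
      ((rPlus M a - rMinus M a) * θ₁ ^ 2 * (Λ - 2 * a * m * ω)))
    (hXl : Xl = ((rPlus M a ^ 2 + a ^ 2) * (ω - m * horizonAngularVelocity M a)) ^ 2 /
      (8 * (rPlus M a - rMinus M a) * (|Λ - 2 * a * m * ω| + 3)))
    (hn1 : Acap * Xs ≤ 1)
    (hε : εc = 2 * |ω - m * horizonAngularVelocity M a| * Real.exp (Acap * Xs))
    (hCA : CA = (2 * rPlus M a) ^ 2 + a ^ 2) (hc : cQ = θ₁ * (Λ - 2 * a * m * ω) / (32 * CA))
    (hr₃ : r₃ = rPlus M a + 131072 * Xs + 2 * εc / cQ) :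
    100 * εc * (Real.log (r₃ - rPlus M a) - Real.log Xl) / surfaceGravity M a ≤ 1 := by
  have haM : |a| ≤ M := le_of_lt hMa
  have hM : 0 < M := hMa.pos
  have hrp : 0 < rPlus M a := rPlus_pos hM a
  have hMr : M ≤ rPlus M a := M_le_rPlus M a
  have hr2M : rPlus M a ≤ 2 * M := rPlus_le_two_mul_self hM.le a
  have hκ : 0 < surfaceGravity M a := hMa.surfaceGravity_pos
  obtain ⟨hΛ1, hMω, hs1, hs, hΛ', hΛ'3, hP, hd, hT⟩ := sliver_atoms hMa ha hadm hm hε₀ hcone hθ₁.le hBF hσ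
  set Λ' := Λ - 2 * a * m * ω with hΛ'def
  set σ := ω - m * horizonAngularVelocity M a with hσdef
  set P := rPlus M a ^ 2 + a ^ 2 with hPdef
  set d := rPlus M a - rMinus M a with hddef
  set T := |P * σ| with hTdef
  have hP0 : 0 < P := by rw [hPdef]; positivity
  have hd0 : 0 < d := by rw [hd]; positivity
  have hΛ'0 : 0 < Λ' := by linarith only [hΛ', hΛ1]
  have hσa : 0 < |σ| := abs_pos.2 hσ0
  have hTeq : T = P * |σ| := by rw [hTdef, abs_mul, abs_of_pos hP0]
  have hT0 : 0 < T := by rw [hTeq]; positivity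
  have hTd : T ≤ ξ₁ * d := hT
  have hPr : rPlus M a ^ 2 ≤ P := by
    rw [hP]; have := mul_le_mul_of_nonneg_right hr2M hrp.le; nlinarith only [this]
  have ha2 : a ^ 2 ≤ rPlus M a ^ 2 := by
    have h1 : |a| ≤ rPlus M a := haM.trans hMr
    have h2 := mul_le_mul h1 h1 (abs_nonneg a) hrp.le
    rw [← sq_abs a]; nlinarith only [h2]
  have hξ1 : ξ₁ ≤ 1e-18 := hξ₁le.trans (by
    have : θ₁ ^ 4 ≤ 1 := pow_le_one₀ hθ₁.le hθ₁1; linarith only [this])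
  -- `X* = 24T²/(dθ₁²Λ′)`, `X_low = T²/(8d(|Λ′|+3))`
  have hXs' : Xs = 24 * T ^ 2 / (d * θ₁ ^ 2 * Λ') := by rw [hXs, hTdef, sq_abs]
  have hXl' : Xl = T ^ 2 / (8 * d * (|Λ'| + 3)) := by rw [hXl, hTdef, sq_abs]
  have hXs0 : 0 < Xs := by rw [hXs']; positivity
  have hXl0 : 0 < Xl := by rw [hXl']; positivity
  -- `ε_c ≤ 6|σ|`, `C_A ≤ 5P`, `2ε_c/c_Q ≤ 1920 T/(θ₁Λ′)`
  have hεle : εc ≤ 6 * |σ| := by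
    rw [hε]
    have h1 : Real.exp (Acap * Xs) ≤ Real.exp 1 := Real.exp_le_exp.2 hn1
    have h2 : Real.exp 1 ≤ 3 := by have := Real.exp_one_lt_d9; linarith only [this]
    have h3 := mul_le_mul_of_nonneg_left (h1.trans h2) (show 0 ≤ 2 * |σ| by positivity)
    linarith only [h3]
  have hε0 : 0 ≤ εc := by rw [hε]; positivity
  have hCA0 : 0 < CA := by rw [hCA]; positivity
  have hCAP : CA ≤ 5 * P := by rw [hCA]; nlinarith only [ha2, hPr]
  have hcQ0 : 0 < cQ := by rw [hc]; positivity
  have hgain : 2 * εc / cQ ≤ 1920 * T / (θ₁ * Λ') := by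
    rw [hc, div_div_eq_mul_div, div_le_div_iff₀ (by positivity) (by positivity)]
    have h1 : εc * CA ≤ 6 * |σ| * (5 * P) := mul_le_mul hεle hCAP hCA0.le (by positivity)
    have h2 : |σ| * P = T := by rw [hTeq]; ring
    have h3 : εc * CA ≤ 30 * T := by nlinarith only [h1, h2]
    have h4 := mul_le_mul_of_nonneg_right h3 (show 0 ≤ θ₁ * Λ' by positivity)
    nlinarith only [h4]
  -- the ratio `(r₃ − r₊)/X_low ≤ Q := 3.88·10¹⁰ d/(θ₁² T)`
  have hr₃pos : 0 < r₃ - rPlus M a := by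
    rw [hr₃]; have : 0 ≤ 2 * εc / cQ := by positivity
    linarith only [hXs0, this]
  set u := T / d with hu
  have hu0 : 0 < u := by rw [hu]; positivity
  have huξ : u ≤ ξ₁ := by rw [hu, div_le_iff₀ hd0]; exact hTd
  have hu1 : u ≤ 1 := huξ.trans (hξ1.trans (by norm_num))
  set Q := 3.88e10 / (θ₁ ^ 2 * u) with hQ
  have hQ0 : 0 < Q := by rw [hQ]; positivity
  have hratio : (r₃ - rPlus M a) / Xl ≤ Q := by
    rw [div_le_iff₀ hXl0, hr₃, hXl']
    -- `131072 X* + 2ε/c_Q ≤ 3145728 T²/(dθ₁²Λ′) + 1920 T/(θ₁Λ′)` and `|Λ′| + 3 ≤ 6Λ ≤ 1536 Λ′`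
    have h1 : rPlus M a + 131072 * Xs + 2 * εc / cQ - rPlus M a ≤
        3145728 * T ^ 2 / (d * θ₁ ^ 2 * Λ') + 1920 * T / (θ₁ * Λ') := by
      have e : 131072 * Xs = 3145728 * T ^ 2 / (d * θ₁ ^ 2 * Λ') := by rw [hXs']; ring
      linarith only [hgain, e]
    refine h1.trans ?_
    have hΛ6 : |Λ'| + 3 ≤ 1536 * Λ' := by linarith only [hΛ'3, hΛ', hΛ1]
    -- `Q · T²/(8d(|Λ′|+3)) ≥ Q T²/(12288 d Λ′)` and this dominates both terms
    have h2 : Q * (T ^ 2 / (8 * d * (1536 * Λ'))) ≤ Q * (T ^ 2 / (8 * d * (|Λ'| + 3))) := by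
      apply mul_le_mul_of_nonneg_left _ hQ0.le
      apply div_le_div_of_nonneg_left (sq_nonneg _) (by positivity)
      have := mul_le_mul_of_nonneg_left hΛ6 (show 0 ≤ 8 * d by positivity)
      linarith only [this]
    refine le_trans ?_ h2
    rw [hQ, hu]
    -- both sides explicit: `3145728 T²/(dθ₁²Λ′) + 1920 T/(θ₁Λ′) ≤ 3.88e10 d/(θ₁² T) · T²/(12288 dΛ′)`
    have e : 3.88e10 / (θ₁ ^ 2 * (T / d)) * (T ^ 2 / (8 * d * (1536 * Λ'))) =
        3.88e10 / 12288 * T / (θ₁ ^ 2 * Λ') := by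
      field_simp
      ring
    rw [e]
    -- `3145728 T²/(dθ₁²Λ′) ≤ 3145728 ξ₁ T/(θ₁²Λ′)` (`T ≤ ξ₁ d`), `1920 T/(θ₁Λ′) ≤ 1920 T/(θ₁²Λ′)`
    have h3 : 3145728 * T ^ 2 / (d * θ₁ ^ 2 * Λ') ≤ 3145728 * ξ₁ * T / (θ₁ ^ 2 * Λ') := by
      rw [div_le_div_iff₀ (by positivity) (by positivity)]
      have h6 := mul_le_mul_of_nonneg_left hTd hT0.le
      have h7 := mul_le_mul_of_nonneg_right h6 (show 0 ≤ 3145728 * (θ₁ ^ 2 * Λ') by positivity)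
      have e : T * (ξ₁ * d) * (3145728 * (θ₁ ^ 2 * Λ')) = 3145728 * ξ₁ * T * (d * θ₁ ^ 2 * Λ') := by ring
      have e' : T * T * (3145728 * (θ₁ ^ 2 * Λ')) = 3145728 * T ^ 2 * (θ₁ ^ 2 * Λ') := by ring
      linarith only [h7, e, e']
    have h4 : 1920 * T / (θ₁ * Λ') ≤ 1920 * T / (θ₁ ^ 2 * Λ') := by
      apply div_le_div_of_nonneg_left (by positivity) (by positivity)
      have h6 : θ₁ ^ 2 ≤ θ₁ := by
        have := mul_le_mul_of_nonneg_right hθ₁1 hθ₁.le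
        have e : θ₁ * θ₁ = θ₁ ^ 2 := (sq θ₁).symm
        linarith only [this, e]
      exact mul_le_mul_of_nonneg_right h6 hΛ'0.le
    have h5 : 3145728 * ξ₁ * T / (θ₁ ^ 2 * Λ') + 1920 * T / (θ₁ ^ 2 * Λ') ≤
        3.88e10 / 12288 * T / (θ₁ ^ 2 * Λ') := by
      rw [← add_div, div_le_div_iff_of_pos_right (by positivity)]
      have := mul_le_mul_of_nonneg_right hξ1 hT0.le
      nlinarith only [this, hT0]
    linarith only [h3, h4, h5]
  -- `log(r₃ − r₊) − log X_low ≤ log Q ≤ 2√Q` (`log √Q ≤ √Q − 1`)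
  have hlogQ : Real.log Q ≤ 2 * Real.sqrt Q := by
    have h1 : Real.log (Real.sqrt Q) ≤ Real.sqrt Q - 1 := Real.log_le_sub_one_of_pos (Real.sqrt_pos.2 hQ0)
    have h2 : Real.log (Real.sqrt Q) = Real.log Q / 2 := Real.log_sqrt hQ0.le
    rw [h2] at h1
    linarith only [h1]
  have hlog : Real.log (r₃ - rPlus M a) - Real.log Xl ≤ 2 * Real.sqrt Q := by
    rw [← Real.log_div hr₃pos.ne' hXl0.ne']
    exact (Real.log_le_log (div_pos hr₃pos hXl0) hratio).trans hlogQ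
  -- `100ε/κ ≤ 1200 u`: `ε ≤ 6|σ| = 6T/P`, `d = 2Pκ`
  have hεκ : 100 * εc / surfaceGravity M a ≤ 1200 * u := by
    rw [div_le_iff₀ hκ, hu]
    have h1 : |σ| = T / P := by rw [hTeq]; field_simp
    have h2 : surfaceGravity M a = d / (2 * P) := by rw [hd]; field_simp
    rw [h2]
    have : 100 * εc ≤ 600 * (T / P) := by rw [← h1]; linarith only [hεle]
    calc 100 * εc ≤ 600 * (T / P) := this
      _ = 1200 * (T / d) * (d / (2 * P)) := by field_simp; norm_num
  -- assemble: `1200 u · 2√Q ≤ 1` since `(2400 u √Q)² = 5.76e6 u² Q = 2.23e17 u/θ₁² ≤ 1`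
  have hprod : 1200 * u * (2 * Real.sqrt Q) ≤ 1 := by
    have h0 : 0 ≤ 1200 * u * (2 * Real.sqrt Q) := by positivity
    have h1 : (1200 * u * (2 * Real.sqrt Q)) ^ 2 ≤ 1 := by
      have e : (1200 * u * (2 * Real.sqrt Q)) ^ 2 = 5.76e6 * u ^ 2 * Q := by
        rw [mul_pow, mul_pow, mul_pow, Real.sq_sqrt hQ0.le]; ring
      rw [e, hQ]
      have e2 : 5.76e6 * u ^ 2 * (3.88e10 / (θ₁ ^ 2 * u)) = 2.23488e17 * u / θ₁ ^ 2 := by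
        field_simp; ring
      rw [e2, div_le_one (by positivity)]
      have h6 : u ≤ 1e-18 * θ₁ ^ 4 := huξ.trans hξ₁le
      have h7 : θ₁ ^ 4 ≤ θ₁ ^ 2 := pow_le_pow_of_le_one hθ₁.le hθ₁1 (by norm_num)
      linarith only [h6, h7, sq_nonneg θ₁]
    exact (pow_le_one_iff_of_nonneg h0 two_ne_zero).1 h1
  -- final
  rcases le_or_gt 0 (Real.log (r₃ - rPlus M a) - Real.log Xl) with hpos | hneg
  · calc 100 * εc * (Real.log (r₃ - rPlus M a) - Real.log Xl) / surfaceGravity M a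
        = 100 * εc / surfaceGravity M a * (Real.log (r₃ - rPlus M a) - Real.log Xl) := by ring
      _ ≤ 1200 * u * (2 * Real.sqrt Q) := mul_le_mul hεκ hlog hpos (by positivity)
      _ ≤ 1 := hprod
  · have : 100 * εc * (Real.log (r₃ - rPlus M a) - Real.log Xl) / surfaceGravity M a ≤ 0 :=
      div_nonpos_of_nonpos_of_nonneg (mul_nonpos_of_nonneg_of_nonpos (by positivity) hneg.le) hκ.le
    linarith only [this]

end SliverLog

end Kerr

end Literature.Geometry.Lorentzian

end
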